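import Mathlib
import Summits.NavierStokesRegularity.NavierStokesRegularity.Theorems.EulerZoomLiouvillePowerGaugeEulerLiouvilleSelfSimilarSwirlFatTail
import HarnessLib

/-!
# Crux E `PowerGaugeEulerLiouville` (stmt-NavierStokesRegularity-19832), THE ONE STATEMENT: THE SWIRL DISTRIBUTION OF AN AXISYMMETRIC PROFILE IS AN EXACT POWER LAW
# `vol{|Γ| > μ} = K μ^{−3γ/(1−2γ)}` (class: `K μ^{−3/ρ}`), and the `A`-gauge swirl bound (T1 tools; width seat ns-ezl-w3 g3)

Route №10 `EulerZoomLiouville` (NavierStokesRegularity), crux E; LEAD ns-typeII-p2 g12; target T1 of RESIDUE-MEMO §2.  The two halves of the volume law of the swirl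
distribution `m(μ) = vol{y | μ < |Γ(y)|}` (`Γ = swirl V = rV_θ`; forward `e^{3γs}m(μ) ≤ m(μe^{−(1−2γ)s})`, (C3) p641629 `volume_superlevel_ratchet`; backward
`m(μe^{−(1−2γ)s}) ≤ e^{3γs}m(μ)`, (C5) p642450 `volume_superlevel_ratchet_backward`) combine to the EXACT LAW `m(μe^{−(1−2γ)s}) = e^{3γs} m(μ)` (`volume_superlevel_swirl_law`)
for an axisymmetric `C²` self-similar profile of linear growth, `0 < γ`; for `γ < ½` every level `μ > 0` is reached from `μ = 1`, so
**`m(μ) = μ^{−3γ/(1−2γ)} · m(1)`** for all `μ > 0` (`volume_superlevel_swirl_powerlaw`; class `γ = 1/(2+ρ)`: exponent `−3/ρ`, `volume_superlevel_swirl_powerlaw_class`).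
So the needle's swirl distribution is one number `K = vol{|Γ| > 1} ∈ [0, ∞]`: `K = 0` ⟺ swirl-free; `0 < K < ∞` ⟹ every Casimir `∫|Γ|^q` is infinite and the support has
infinite volume; `K = ∞` ⟹ every superlevel set has infinite volume.  Second tool: the `A`-gauge in swirl form, `∫⁻_{B_L} ofReal(Γ²/r²) ≤ c · L^{1−2ρ}`
(`lintegral_ball_sq_swirl_div_le`; `Γ²/r² = V_θ² ≤ |V|²`, `EnergySaturation.profileData_of_selfSimilar`), hence `vol({|Γ| > μ} ∩ B_L) ≤ c L^{3−2ρ}/μ²`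
(`volume_superlevel_swirl_inter_ball_le`): at fixed level the power-law mass `Kμ^{−3/ρ}` sits OUTSIDE every ball up to `cL^{3−2ρ}μ^{−2}`.
WHAT THIS IS NOT: not NS regularity, not the crux E, not a kill — portrait/tool lemmas for the registered residue (N4′) of the crux CLASS 19832 (MODEL lattice; E/NS strata),
`--supports` stmt-19832; 19832 OPEN. [cite: Chae2007CMPEuler, Thm 2.2 + Note added p. 6; CaffarelliKohnNirenberg1982 §2 (`A`-quantity)]
-/

noncomputable section

-- flat `Theorems/<Route><Decl>…` files of one crux share the namespace of the crux (tree convention: `Summit.<S>.<S>.…`)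
set_option linter.dupNamespace false

open MeasureTheory Set Filter Topology Metric Function InnerProductSpace
open scoped RealInnerProductSpace NNReal ENNReal ContDiff

namespace Summit.NavierStokesRegularity.NavierStokesRegularity.Theorems.PowerGaugeEulerLiouville

open Literature.Analysis Literature.Analysis.FluidPDE Literature.Analysis.FunctionSpaces

namespace SwirlRatchet

variable {γ : ℝ} {U : EuclideanSpace ℝ (Fin 3) → EuclideanSpace ℝ (Fin 3)} {P : EuclideanSpace ℝ (Fin 3) → ℝ}

/-- **THE EXACT VOLUME LAW OF THE SWIRL DISTRIBUTION**: `vol{μe^{−(1−2γ)s} < |Γ|} = e^{3γs} · vol{μ < |Γ|}` for every level `μ` and every `s ≥ 0` (the forward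
and backward halves (C3)/(C5) together). [cite: Chae2007CMPEuler, Thm 2.2 + Note added p. 6] -/
theorem volume_superlevel_swirl_law (h : IsSelfSimilarEulerProfile γ 0 U P) (hU : IsAxisymmetric U) (hγ : 0 < γ)
    {K₁ : ℝ} (hlin : ∀ y, ‖U y‖ ≤ K₁ * (1 + ‖y‖)) (μ : ℝ) {s : ℝ} (hs : 0 ≤ s) :
    volume {y : EuclideanSpace ℝ (Fin 3) | μ * Real.exp (-((1 - 2 * γ) * s)) < |swirl U y|} =
      ENNReal.ofReal (Real.exp (3 * γ * s)) * volume {y : EuclideanSpace ℝ (Fin 3) | μ < |swirl U y|} :=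
  le_antisymm (volume_superlevel_ratchet_backward h hU hγ hlin μ hs) (volume_superlevel_ratchet h hU hγ hlin μ hs)

/-- **THE SWIRL DISTRIBUTION IS AN EXACT POWER LAW** (`0 < γ < ½`, axisymmetric `C²` profile of linear growth): for every `μ > 0`,
`vol{μ < |Γ|} = μ^{−3γ/(1−2γ)} · vol{1 < |Γ|}`. [cite: Chae2007CMPEuler, Thm 2.2 + Note added p. 6] -/
theorem volume_superlevel_swirl_powerlaw (h : IsSelfSimilarEulerProfile γ 0 U P) (hU : IsAxisymmetric U) (hγ : 0 < γ) (hγ2 : γ < 1 / 2)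
    {K₁ : ℝ} (hlin : ∀ y, ‖U y‖ ≤ K₁ * (1 + ‖y‖)) {μ : ℝ} (hμ : 0 < μ) :
    volume {y : EuclideanSpace ℝ (Fin 3) | μ < |swirl U y|} =
      ENNReal.ofReal (μ ^ (-(3 * γ / (1 - 2 * γ)))) * volume {y : EuclideanSpace ℝ (Fin 3) | 1 < |swirl U y|} := by
  have h12 : 0 < 1 - 2 * γ := by linarith
  -- the time `s` with `e^{−(1−2γ)s} = min-side level`, and the identity `e^{3γs} = level^{−3γ/(1−2γ)}`
  have hpow : ∀ {ν : ℝ}, 0 < ν → ν ≤ 1 →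
      Real.exp (3 * γ * (-Real.log ν / (1 - 2 * γ))) = ν ^ (-(3 * γ / (1 - 2 * γ))) := by
    intro ν hν _
    rw [Real.rpow_def_of_pos hν]
    congr 1
    rw [div_eq_mul_inv, div_eq_mul_inv]; ring
  rcases le_or_gt μ 1 with hμ1 | hμ1
  · -- `μ ≤ 1`: run the law from level `1` down to `μ`: `s = −log μ/(1−2γ) ≥ 0`, `1·e^{−(1−2γ)s} = μ`
    set s : ℝ := -Real.log μ / (1 - 2 * γ) with hsdef
    have hs : 0 ≤ s := by rw [hsdef]; exact div_nonneg (neg_nonneg.2 (Real.log_nonpos hμ.le hμ1)) h12.le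
    have hlaw := volume_superlevel_swirl_law h hU hγ hlin 1 hs
    have h1 : (1 : ℝ) * Real.exp (-((1 - 2 * γ) * s)) = μ := by
      rw [one_mul, hsdef]
      have : -((1 - 2 * γ) * (-Real.log μ / (1 - 2 * γ))) = Real.log μ := by field_simp
      rw [this, Real.exp_log hμ]
    rw [h1, hsdef, hpow hμ hμ1] at hlaw
    exact hlaw
  · -- `μ > 1`: run the law from level `μ` down to `1`: `s = log μ/(1−2γ)`, `μ e^{−(1−2γ)s} = 1`, then divide by `e^{3γs} = μ^{3γ/(1−2γ)}`
    set s : ℝ := Real.log μ / (1 - 2 * γ) with hsdef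
    have hs : 0 ≤ s := by rw [hsdef]; exact div_nonneg (Real.log_nonneg hμ1.le) h12.le
    have hlaw := volume_superlevel_swirl_law h hU hγ hlin μ hs
    have h1 : μ * Real.exp (-((1 - 2 * γ) * s)) = 1 := by
      rw [hsdef]
      have : -((1 - 2 * γ) * (Real.log μ / (1 - 2 * γ))) = -Real.log μ := by field_simp
      rw [this, Real.exp_neg, Real.exp_log hμ]; field_simp
    have hexp : Real.exp (3 * γ * s) = μ ^ (3 * γ / (1 - 2 * γ)) := by
      rw [Real.rpow_def_of_pos hμ]; congr 1; rw [hsdef, div_eq_mul_inv, div_eq_mul_inv]; ring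
    rw [h1, hexp] at hlaw
    -- `vol{1<|Γ|} = μ^{a} vol{μ<|Γ|}` ⇒ `vol{μ<|Γ|} = μ^{−a} vol{1<|Γ|}`
    have hμa : 0 < μ ^ (3 * γ / (1 - 2 * γ)) := Real.rpow_pos_of_pos hμ _
    rw [hlaw, ← mul_assoc, ← ENNReal.ofReal_mul (Real.rpow_nonneg hμ.le _), Real.rpow_neg hμ.le,
      inv_mul_cancel₀ hμa.ne', ENNReal.ofReal_one, one_mul]

/-- In the class (`γ = 1/(2+ρ)`, `ρ > 0`): `3γ/(1−2γ) = 3/ρ`. [folklore] -/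
theorem swirl_powerlaw_exponent {ρ : ℝ} (hρ : 0 < ρ) : 3 * (1 / (2 + ρ)) / (1 - 2 * (1 / (2 + ρ))) = 3 / ρ := by
  have h2ρ : (2 : ℝ) + ρ ≠ 0 := by linarith
  have hρ0 : ρ ≠ 0 := hρ.ne'
  have e1 : 1 - 2 * (1 / (2 + ρ)) = ρ / (2 + ρ) := one_sub_two_mul_exponent hρ
  rw [e1]
  field_simp

/-- **THE CLASS FORM: `vol{μ < |Γ|} = μ^{−3/ρ} · vol{1 < |Γ|}`** for an axisymmetric `C²` self-similar profile of linear growth at the class rate `γ = 1/(2+ρ)`, `0 < ρ`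
(then `γ < ½` automatically), every `μ > 0`. [cite: Chae2007CMPEuler, Thm 2.2 + Note added p. 6] -/
theorem volume_superlevel_swirl_powerlaw_class {ρ : ℝ} (hρ : 0 < ρ) (h : IsSelfSimilarEulerProfile (1 / (2 + ρ)) 0 U P) (hU : IsAxisymmetric U)
    {K₁ : ℝ} (hlin : ∀ y, ‖U y‖ ≤ K₁ * (1 + ‖y‖)) {μ : ℝ} (hμ : 0 < μ) :
    volume {y : EuclideanSpace ℝ (Fin 3) | μ < |swirl U y|} =
      ENNReal.ofReal (μ ^ (-(3 / ρ))) * volume {y : EuclideanSpace ℝ (Fin 3) | 1 < |swirl U y|} := by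
  have h2ρ : (0 : ℝ) < 2 + ρ := by linarith
  have hγ : (0 : ℝ) < 1 / (2 + ρ) := by positivity
  have hγ2 : 1 / (2 + ρ) < 1 / 2 := one_div_lt_one_div_of_lt two_pos (by linarith)
  rw [← swirl_powerlaw_exponent hρ]
  exact volume_superlevel_swirl_powerlaw h hU hγ hγ2 hlin hμ

/-! ### The `A`-gauge in swirl form -/

/-- `Γ²/r² ≤ |V|²` pointwise (`Γ = rV_θ`; Lagrange's identity; on the axis the left side is `0`). [folklore] -/
theorem sq_swirl_div_sq_cylRadius_le (V : EuclideanSpace ℝ (Fin 3) → EuclideanSpace ℝ (Fin 3)) (y : EuclideanSpace ℝ (Fin 3)) :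
    swirl V y ^ 2 / cylRadius y ^ 2 ≤ ‖V y‖ ^ 2 := by
  have hL : swirl V y ^ 2 ≤ cylRadius y ^ 2 * (V y 0 ^ 2 + V y 1 ^ 2) := by
    rw [cylRadius_sq]
    simp only [swirl]
    nlinarith [sq_nonneg (y 0 * V y 0 + y 1 * V y 1)]
  have hh : V y 0 ^ 2 + V y 1 ^ 2 ≤ ‖V y‖ ^ 2 := by
    rw [EuclideanSpace.norm_sq_eq, Fin.sum_univ_three]
    simp only [Real.norm_eq_abs, sq_abs]
    nlinarith [sq_nonneg (V y 2)]
  rcases eq_or_ne (cylRadius y) 0 with hr | hr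
  · rw [hr]; simp
  · rw [div_le_iff₀ (by positivity)]
    calc swirl V y ^ 2 ≤ cylRadius y ^ 2 * (V y 0 ^ 2 + V y 1 ^ 2) := hL
      _ ≤ cylRadius y ^ 2 * ‖V y‖ ^ 2 := mul_le_mul_of_nonneg_left hh (sq_nonneg _)
      _ = ‖V y‖ ^ 2 * cylRadius y ^ 2 := mul_comm _ _

variable {u : ℝ → EuclideanSpace ℝ (Fin 3) → EuclideanSpace ℝ (Fin 3)} {p : ℝ → EuclideanSpace ℝ (Fin 3) → ℝ}
  {H : ℝ → EuclideanSpace ℝ (Fin 3) → EuclideanSpace ℝ (Fin 3) →L[ℝ] EuclideanSpace ℝ (Fin 3)} {c : ℝ≥0}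
  {V : EuclideanSpace ℝ (Fin 3) → EuclideanSpace ℝ (Fin 3)}

/-- **THE `A`-GAUGE SWIRL BOUND**: for an exactly self-similar member of the class (crux binders VERBATIM, `0 < ρ < 1`) with profile `V` and every `L > 0`,
`∫⁻_{B_L} ofReal(Γ²/r²) ≤ c · L^{1−2ρ}` (the lineage's `A`-growth `∫_{B_L}|V|² ≤ cL^{1−2ρ}` and `Γ²/r² ≤ |V|²`). [cite: CaffarelliKohnNirenberg1982, §2 (`A`-quantity)] -/
theorem lintegral_ball_sq_swirl_div_le {ρ : ℝ} (hρ : 0 < ρ) (hρ1 : ρ < 1)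
    (hsw : IsSuitableWeakSolutionOn (slab (EuclideanSpace ℝ (Fin 3)) (Iio 0) isOpen_Iio) 0 0 u p)
    (hH : HasWeakSpatialGradientOn (slab (EuclideanSpace ℝ (Fin 3)) (Iio 0) isOpen_Iio) u H)
    (hgauge : ∀ a : ℝ, 0 < a →
      ENNReal.ofReal (a ^ (2 * ρ)) * cknA a (0 : ℝ × EuclideanSpace ℝ (Fin 3)) u +
          ENNReal.ofReal (a ^ ρ) * cknE a (0 : ℝ × EuclideanSpace ℝ (Fin 3)) H +
        ENNReal.ofReal (a ^ (2 * ρ)) * cknD a (0 : ℝ × EuclideanSpace ℝ (Fin 3)) p ≤ (c : ENNReal))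
    (hu : ∀ τ : ℝ, τ < 0 → u τ = selfSimilarCollapse (1 / (2 + ρ)) 0 V τ)
    (hp : ∀ τ : ℝ, τ < 0 → p τ = selfSimilarCollapsePressure (1 / (2 + ρ)) 0 P τ)
    {L : ℝ} (hL : 0 < L) :
    ∫⁻ y in ball (0 : EuclideanSpace ℝ (Fin 3)) L, ENNReal.ofReal (swirl V y ^ 2 / cylRadius y ^ 2) ≤
      (c : ℝ≥0∞) * ENNReal.ofReal (L ^ (1 - 2 * ρ)) := by
  obtain ⟨G, -, -, -, -, -, hA, -⟩ := EnergySaturation.profileData_of_selfSimilar hρ hρ1 hsw hH hgauge hu hp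
  refine le_trans (lintegral_mono fun y => ?_) (hA L hL)
  calc ENNReal.ofReal (swirl V y ^ 2 / cylRadius y ^ 2) ≤ ENNReal.ofReal (‖V y‖ ^ 2) := ENNReal.ofReal_le_ofReal (sq_swirl_div_sq_cylRadius_le V y)
    _ = ‖V y‖ₑ ^ 2 := by rw [← ofReal_norm, ENNReal.ofReal_pow (norm_nonneg _)]

/-- **The swirl superlevel sets inside balls are `A`-small**: for a continuous profile, `ofReal(μ²/L²) · vol({μ < |Γ|} ∩ B_L) ≤ c · L^{1−2ρ}`, i.e.
`vol({μ < |Γ|} ∩ B_L) ≤ c L^{3−2ρ}/μ²` (`Γ²/r² ≥ μ²/L²` on that set since `0 < r ≤ ‖y‖ < L`; Chebyshev). [cite: CaffarelliKohnNirenberg1982, §2] -/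
theorem volume_superlevel_swirl_inter_ball_le {ρ : ℝ} (hρ : 0 < ρ) (hρ1 : ρ < 1)
    (hsw : IsSuitableWeakSolutionOn (slab (EuclideanSpace ℝ (Fin 3)) (Iio 0) isOpen_Iio) 0 0 u p)
    (hH : HasWeakSpatialGradientOn (slab (EuclideanSpace ℝ (Fin 3)) (Iio 0) isOpen_Iio) u H)
    (hgauge : ∀ a : ℝ, 0 < a →
      ENNReal.ofReal (a ^ (2 * ρ)) * cknA a (0 : ℝ × EuclideanSpace ℝ (Fin 3)) u +
          ENNReal.ofReal (a ^ ρ) * cknE a (0 : ℝ × EuclideanSpace ℝ (Fin 3)) H +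
        ENNReal.ofReal (a ^ (2 * ρ)) * cknD a (0 : ℝ × EuclideanSpace ℝ (Fin 3)) p ≤ (c : ENNReal))
    (hu : ∀ τ : ℝ, τ < 0 → u τ = selfSimilarCollapse (1 / (2 + ρ)) 0 V τ)
    (hp : ∀ τ : ℝ, τ < 0 → p τ = selfSimilarCollapsePressure (1 / (2 + ρ)) 0 P τ)
    (hVc : Continuous V) {L μ : ℝ} (hL : 0 < L) (hμ : 0 < μ) :
    ENNReal.ofReal (μ ^ 2 / L ^ 2) * volume ({y : EuclideanSpace ℝ (Fin 3) | μ < |swirl V y|} ∩ ball 0 L) ≤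
      (c : ℝ≥0∞) * ENNReal.ofReal (L ^ (1 - 2 * ρ)) := by
  set S : Set (EuclideanSpace ℝ (Fin 3)) := {y | μ < |swirl V y|} ∩ ball 0 L with hS
  have hΓc : Continuous (swirl V) := by
    rw [swirl_eq_inner_rotGen]
    exact (rotGenL.continuous.congr fun y => rotGenL_apply y).inner hVc
  have hSm : MeasurableSet S := (isOpen_lt continuous_const (continuous_abs.comp hΓc)).measurableSet.inter measurableSet_ball
  -- pointwise on `S`: `μ²/L² ≤ Γ²/r²`
  have hpt : ∀ y ∈ S, ENNReal.ofReal (μ ^ 2 / L ^ 2) ≤ ENNReal.ofReal (swirl V y ^ 2 / cylRadius y ^ 2) := by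
    intro y hy
    obtain ⟨hyμ, hyL⟩ := hy
    have hyμ : μ < |swirl V y| := hyμ
    rw [mem_ball_zero_iff] at hyL
    have hr0 : cylRadius y ≠ 0 := by
      intro h0
      have := swirl_eq_zero_of_cylRadius_eq_zero V h0
      rw [this, abs_zero] at hyμ
      linarith
    have hrpos : 0 < cylRadius y := lt_of_le_of_ne (cylRadius_nonneg y) (Ne.symm hr0)
    have hrle : cylRadius y ≤ ‖y‖ := by
      rw [cylRadius, EuclideanSpace.norm_eq, Fin.sum_univ_three]
      simp only [Real.norm_eq_abs, sq_abs]
      exact Real.sqrt_le_sqrt (by nlinarith [sq_nonneg (y 2)])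
    refine ENNReal.ofReal_le_ofReal ?_
    rw [div_le_div_iff₀ (by positivity) (by positivity)]
    have h1 : μ ^ 2 ≤ swirl V y ^ 2 := by
      have := sq_lt_sq' (by linarith [abs_nonneg (swirl V y)]) hyμ
      rw [sq_abs] at this; exact this.le
    have h2 : cylRadius y ^ 2 ≤ L ^ 2 := pow_le_pow_left₀ (cylRadius_nonneg y) (hrle.trans hyL.le) 2
    calc μ ^ 2 * cylRadius y ^ 2 ≤ swirl V y ^ 2 * cylRadius y ^ 2 := mul_le_mul_of_nonneg_right h1 (sq_nonneg _)
      _ ≤ swirl V y ^ 2 * L ^ 2 := mul_le_mul_of_nonneg_left h2 (sq_nonneg _)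
  calc ENNReal.ofReal (μ ^ 2 / L ^ 2) * volume S = ∫⁻ _ in S, ENNReal.ofReal (μ ^ 2 / L ^ 2) := (setLIntegral_const S _).symm
    _ ≤ ∫⁻ y in S, ENNReal.ofReal (swirl V y ^ 2 / cylRadius y ^ 2) := setLIntegral_mono' hSm hpt
    _ ≤ ∫⁻ y in ball (0 : EuclideanSpace ℝ (Fin 3)) L, ENNReal.ofReal (swirl V y ^ 2 / cylRadius y ^ 2) :=
        lintegral_mono_set inter_subset_right
    _ ≤ (c : ℝ≥0∞) * ENNReal.ofReal (L ^ (1 - 2 * ρ)) := lintegral_ball_sq_swirl_div_le hρ hρ1 hsw hH hgauge hu hp hL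

end SwirlRatchet

end Summit.NavierStokesRegularity.NavierStokesRegularity.Theorems.PowerGaugeEulerLiouville

end
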